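import Mathlib.Tactic

/-!
# Closed-form consistency of the sheaf form Λ″ of the W4 evaluation-rank law

Pure ring identities behind PROPOSITION C of the W4 note `SIGMA-w4rep2g10.md` (pub-hsemireg, W4,
w4-rep-2 gen 10).  Setting (integers or any commutative ring): a cell has A-group `ℤ/n × ℤ/nd'` and
B-group `ℤ/m × ℤ/md`; the law's candidate is a matrix `M = ((a,b),(c,e))` with `det M = 1` and
`Mᵀ diag(d,-d') M = diag(dB, -dA')`, i.e.
`d a² - d' c² = dB`, `d b² - d' e² = -dA'`, `d a b - d' c e = 0`, and `(m,n)ᵀ = M (s,t)ᵀ`.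
The conjectured Mukai vectors are `v(𝒦) = (dB s², -m c s, dA' (m c)²)` and
`v(𝒬) = (dA' t², m e t, dB (m e)²)` (middle entry = coefficient of the polarisation class `ν̄`,
`ν̄² = 2 d d'`).  We check, as identities:
* `dB * dA' = d * d'` (so both vectors are isotropic: `e k² = r χ` with `e = d d'`);
* the three entries of `v(𝒬) - v(𝒦) = v(E) - χ v(𝒪) = (n² d' - m² d, n m, m² d)`.
No geometry is formalised here; these are the algebraic facts that make Λ″ integral, isotropic and
additive for every cell at once.  Honest framing: nothing here says HC / HC_CM / HC_AV is proved.
-/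

namespace Summit.Ventures.HSemireg.LambdaSheafForm

variable {R : Type*} [CommRing R]

/-- Brahmagupta/determinant identity: if `Mᵀ diag(d,-d') M = diag(dB,-dA')` and `det M = 1`
then `dB * dA' = d * d'`. -/
theorem dB_mul_dA' (a b c e d d' dB dA' : R)
    (h1 : d * a ^ 2 - d' * c ^ 2 = dB) (h2 : d * b ^ 2 - d' * e ^ 2 = -dA')
    (h3 : d * a * b - d' * c * e = 0) (hdet : a * e - b * c = 1) :
    dB * dA' = d * d' := by
  have key : (d * a ^ 2 - d' * c ^ 2) * (d * b ^ 2 - d' * e ^ 2) - (d * a * b - d' * c * e) ^ 2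
      = -(d * d') * (a * e - b * c) ^ 2 := by ring
  rw [h1, h2, h3, hdet] at key
  linear_combination -key

/-- Isotropy of the kernel vector `v(𝒦) = (dB s², -m c s, dA' (m c)²)`:
`(d d') (m c s)² = (dB s²) (dA' (m c)²)`. -/
theorem kernel_isotropic (a b c e d d' dB dA' m s : R)
    (h1 : d * a ^ 2 - d' * c ^ 2 = dB) (h2 : d * b ^ 2 - d' * e ^ 2 = -dA')
    (h3 : d * a * b - d' * c * e = 0) (hdet : a * e - b * c = 1) :
    (d * d') * (m * c * s) ^ 2 = (dB * s ^ 2) * (dA' * (m * c) ^ 2) := by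
  have h := dB_mul_dA' a b c e d d' dB dA' h1 h2 h3 hdet
  linear_combination (-(m * c * s) ^ 2) * h

/-- Isotropy of the cokernel vector `v(𝒬) = (dA' t², m e t, dB (m e)²)`:
`(d d') (m e t)² = (dA' t²) (dB (m e)²)`. -/
theorem cokernel_isotropic (a b c e d d' dB dA' m t : R)
    (h1 : d * a ^ 2 - d' * c ^ 2 = dB) (h2 : d * b ^ 2 - d' * e ^ 2 = -dA')
    (h3 : d * a * b - d' * c * e = 0) (hdet : a * e - b * c = 1) :
    (d * d') * (m * e * t) ^ 2 = (dA' * t ^ 2) * (dB * (m * e) ^ 2) := by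
  have h := dB_mul_dA' a b c e d d' dB dA' h1 h2 h3 hdet
  linear_combination (-(m * e * t) ^ 2) * h

/-- Additivity, rank entry: `dA' t² - dB s² = n² d' - m² d` when `(m,n)ᵀ = M (s,t)ᵀ`. -/
theorem rank_entry (a b c e d d' dB dA' m n s t : R)
    (h1 : d * a ^ 2 - d' * c ^ 2 = dB) (h2 : d * b ^ 2 - d' * e ^ 2 = -dA')
    (h3 : d * a * b - d' * c * e = 0)
    (hm : m = s * a + t * b) (hn : n = s * c + t * e) :
    dA' * t ^ 2 - dB * s ^ 2 = n ^ 2 * d' - m ^ 2 * d := by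
  subst hm hn
  linear_combination (s ^ 2) * h1 + (t ^ 2) * h2 + (2 * s * t) * h3

/-- Additivity, first-Chern entry: `m e t - (-m c s) = n m`. -/
theorem c1_entry (c e m n s t : R) (hn : n = s * c + t * e) :
    m * e * t + m * c * s = n * m := by
  subst hn; ring

/-- Additivity, Euler-characteristic entry: `dB (m e)² - dA' (m c)² = m² d`
(uses `det M = 1`: the `(1,1)` entry of `M⁻ᵀ diag(dB,-dA') M⁻¹` is `dB e² - dA' c² = d`). -/
theorem chi_entry (a b c e d d' dB dA' m : R)
    (h1 : d * a ^ 2 - d' * c ^ 2 = dB) (h2 : d * b ^ 2 - d' * e ^ 2 = -dA')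
    (h3 : d * a * b - d' * c * e = 0) (hdet : a * e - b * c = 1) :
    dB * (m * e) ^ 2 - dA' * (m * c) ^ 2 = m ^ 2 * d := by
  have hsq : (a * e - b * c) ^ 2 = 1 := by rw [hdet]; ring
  linear_combination (-(m ^ 2 * e ^ 2)) * h1 + (-(m ^ 2 * c ^ 2)) * h2
    + (2 * m ^ 2 * c * e) * h3 + (m ^ 2 * d) * hsq

end Summit.Ventures.HSemireg.LambdaSheafForm
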